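import Literature.Barriers.AtomisticToContinuum.HardDiskLemma5Kernel
import Mathlib.MeasureTheory.Group.MeasurableEquiv
import HarnessLib

/-!
# Translation covariance of the hard-disc specification; tail events and cylinder events under
# translations (Richthammer 2007, §3.2, §3.5, §4.3)

Two ingredients of the proof of Richthammer's Lemma 5 (`Richthammer2007_lemma5_holds`):

* **`γ` is `τ̂`-invariant** [Richthammer2007, §4.3 via Georgii Prop. 9.1; here for `U = U_hc`]:
  `weight_translate`/`gibbsKernel_translate` (`γ_Λ(A | Y + u) = γ_{Λ-u}(A - u | Y)`, by the
  translation invariance of Lebesgue measure on `(ℝ²)^k`, `pi_restrict_eq_map_addRight`, and of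
  the hard core, `hardCoreIn_translate_iff`), whence `IsGibbs.map_translate`: the image
  `μ ∘ g_u⁻¹` of a Gibbs measure under a translation is a Gibbs measure;
* **tail events are translation-stable**: `g_u⁻¹ 𝓕_{𝒳,∞} ⊆ 𝓕_{𝒳,∞}`
  (`forall_isCylinderEvent_compl_box_preimage_translate`, from `g_u⁻¹ 𝓕_{𝒳,Λ_mᶜ} ⊆ 𝓕_{𝒳,Λ_kᶜ}`
  for `Λ_k + u ⊆ Λ_m`; tail events are written `∀ m : ℕ, IsCylinderEvent (Λ_m)ᶜ T`).

(The third ingredient, the extension of the hypothesis from cylinder events to `𝓕_𝒳`, is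
`measure_le_of_forall_cylinderEvents` in `HardDiskLemma5Kernel.lean`.)

## References

* T. Richthammer, *Translation-invariance of two-dimensional Gibbsian point processes*, Comm.
  Math. Phys. 274 (2007) 81–122, arXiv:0706.3637: §3.2 (p. 6), §3.5 (p. 8), §4.3 (p. 10).
-/

noncomputable section

open MeasureTheory Set ProbabilityTheory
open scoped ENNReal

namespace Literature.Barriers.AtomisticToContinuum.HardDisk

open Literature.Analysis.FunctionSpaces

/-! ### Translation covariance of the hard core, of superposition and of the weights -/

/-- **The hard core is translation invariant**: `X + u` satisfies the hard-core constraint in `Λ`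
iff `X` satisfies it in `Λ - u`. [cite: Richthammer2007, §4.3 (p. 10: "`γ` is `τ̂`-invariant")] -/
theorem hardCoreIn_translate_iff (Λ : Set (EuclideanSpace ℝ (Fin 2))) (u : (EuclideanSpace ℝ (Fin 2))) (X : PointConfig (EuclideanSpace ℝ (Fin 2))) :
    HardCoreIn Λ (X.translate u) ↔ HardCoreIn ((· + u) ⁻¹' Λ) X := by
  constructor
  · intro h p hp q hq hpq hΛ
    have hp' : p + u ∈ X.translate u := PointConfig.mem_translate_iff.2 (by simpa using hp)
    have hq' : q + u ∈ X.translate u := PointConfig.mem_translate_iff.2 (by simpa using hq)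
    have key := h (p + u) hp' (q + u) hq' (by simpa using hpq) hΛ
    simpa [dist_add_right] using key
  · intro h p hp q hq hpq hΛ
    have hp' : p - u ∈ X := PointConfig.mem_translate_iff.1 hp
    have hq' : q - u ∈ X := PointConfig.mem_translate_iff.1 hq
    have hΛ' : p - u ∈ (· + u) ⁻¹' Λ ∨ q - u ∈ (· + u) ⁻¹' Λ := by simpa using hΛ
    have key := h (p - u) hp' (q - u) hq' (by simpa [sub_left_inj] using hpq) hΛ'
    simpa [dist_sub_right] using key

/-- **Superposition is translation covariant**:
`(x + u)_Λ (Y + u)_{Λᶜ} = (x_{Λ-u} Y_{(Λ-u)ᶜ}) + u`. [cite: Richthammer2007, §4.3 (p. 10)] -/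
theorem superpose_translate (Λ : Set (EuclideanSpace ℝ (Fin 2))) {k : ℕ} (x : Fin k → (EuclideanSpace ℝ (Fin 2))) (Y : PointConfig (EuclideanSpace ℝ (Fin 2))) (u : (EuclideanSpace ℝ (Fin 2))) :
    superpose Λ (fun i => x i + u) (Y.translate u) = (superpose ((· + u) ⁻¹' Λ) x Y).translate u := by
  ext p
  change (p ∈ Set.range (fun i => x i + u) ∧ p ∈ Λ) ∨ (p ∈ (fun y => y + u) '' Y.carrier ∧ p ∉ Λ) ↔
    p ∈ (fun y => y + u) '' ((Set.range x ∩ (· + u) ⁻¹' Λ) ∪ (Y.carrier ∩ ((· + u) ⁻¹' Λ)ᶜ))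
  constructor
  · rintro (⟨⟨i, rfl⟩, hΛ⟩ | ⟨⟨y, hy, rfl⟩, hΛ⟩)
    · exact ⟨x i, Or.inl ⟨⟨i, rfl⟩, hΛ⟩, rfl⟩
    · exact ⟨y, Or.inr ⟨hy, hΛ⟩, rfl⟩
  · rintro ⟨y, (⟨⟨i, rfl⟩, hΛ⟩ | ⟨hy, hΛ⟩), rfl⟩
    · exact Or.inl ⟨⟨i, rfl⟩, hΛ⟩
    · exact Or.inr ⟨⟨y, hy, rfl⟩, hΛ⟩

/-- Lebesgue measure on `Λ^k` is the image of Lebesgue measure on `(Λ - u)^k` under the shift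
`x ↦ x + (u, …, u)` (translation invariance of `λ^{2k}`). [folklore] -/
theorem pi_restrict_eq_map_addRight (k : ℕ) {Λ : Set (EuclideanSpace ℝ (Fin 2))} (u : (EuclideanSpace ℝ (Fin 2))) :
    (Measure.pi fun _ : Fin k => (volume : Measure (EuclideanSpace ℝ (Fin 2))).restrict Λ) =
      ((Measure.pi fun _ : Fin k => (volume : Measure (EuclideanSpace ℝ (Fin 2))).restrict ((· + u) ⁻¹' Λ)).map
        (MeasurableEquiv.addRight (fun _ : Fin k => u))) := by
  rw [← Measure.restrict_pi_pi, ← Measure.restrict_pi_pi]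
  have hinv : (Measure.pi fun _ : Fin k => (volume : Measure (EuclideanSpace ℝ (Fin 2)))).map
      (MeasurableEquiv.addRight (fun _ : Fin k => u)) = Measure.pi fun _ => volume := by
    rw [MeasurableEquiv.coe_addRight]
    exact map_add_right_eq_self _ _
  conv_lhs => rw [← hinv]
  rw [(MeasurableEquiv.addRight (fun _ : Fin k => u)).measurableEmbedding.restrict_map]
  rfl

/-- **The finite-volume weights are translation covariant**:
`weight z Λ (Y + u) A = weight z (Λ - u) Y (A - u)`, where `A - u = g_u⁻¹(A)` and
`Λ - u = (· + u)⁻¹(Λ)` (change of variables `x ↦ x + u` in each `Λ^k`).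
[cite: Richthammer2007, §4.3 (p. 10: "`γ` is `τ̂`-invariant")] -/
theorem weight_translate (z : ℝ) (Λ : Set (EuclideanSpace ℝ (Fin 2))) (Y : PointConfig (EuclideanSpace ℝ (Fin 2))) (A : Set (PointConfig (EuclideanSpace ℝ (Fin 2)))) (u : (EuclideanSpace ℝ (Fin 2))) :
    weight z Λ (Y.translate u) A = weight z ((· + u) ⁻¹' Λ) Y (PointConfig.translate u ⁻¹' A) := by
  unfold weight
  refine tsum_congr fun k => ?_
  congr 1
  rw [pi_restrict_eq_map_addRight k u, lintegral_map_equiv]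
  refine lintegral_congr fun x => ?_
  have hx : superpose Λ ((MeasurableEquiv.addRight (fun _ : Fin k => u)) x) (Y.translate u) =
      (superpose ((· + u) ⁻¹' Λ) x Y).translate u := by
    rw [MeasurableEquiv.coe_addRight]
    exact superpose_translate Λ x Y u
  rw [hx]
  by_cases hmem : (superpose ((· + u) ⁻¹' Λ) x Y).translate u ∈ A ∩ {X | HardCoreIn Λ X}
  · have hmem' : superpose ((· + u) ⁻¹' Λ) x Y ∈
        PointConfig.translate u ⁻¹' A ∩ {X | HardCoreIn ((· + u) ⁻¹' Λ) X} :=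
      ⟨hmem.1, (hardCoreIn_translate_iff Λ u _).1 hmem.2⟩
    rw [indicator_of_mem hmem, indicator_of_mem hmem']
    rfl
  · have hmem' : superpose ((· + u) ⁻¹' Λ) x Y ∉
        PointConfig.translate u ⁻¹' A ∩ {X | HardCoreIn ((· + u) ⁻¹' Λ) X} :=
      fun h' => hmem ⟨h'.1, (hardCoreIn_translate_iff Λ u _).2 h'.2⟩
    rw [indicator_of_notMem hmem, indicator_of_notMem hmem']

/-- **The specification is translation covariant**: `γ_Λ(A | Y + u) = γ_{Λ-u}(A - u | Y)`
("`γ` is `τ̂`-invariant", the hypothesis of Georgii's Prop. 9.1 used in §4.3).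
[cite: Richthammer2007, §4.3 (p. 10)] -/
theorem gibbsKernel_translate (z : ℝ) (Λ : Set (EuclideanSpace ℝ (Fin 2))) (Y : PointConfig (EuclideanSpace ℝ (Fin 2))) (A : Set (PointConfig (EuclideanSpace ℝ (Fin 2)))) (u : (EuclideanSpace ℝ (Fin 2))) :
    gibbsKernel z Λ (Y.translate u) A =
      gibbsKernel z ((· + u) ⁻¹' Λ) Y (PointConfig.translate u ⁻¹' A) := by
  rw [gibbsKernel, gibbsKernel, weight_translate, weight_translate, Set.preimage_univ]

/-- Translates of bounded windows are bounded. [folklore] -/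
theorem isBounded_preimage_add {Λ : Set (EuclideanSpace ℝ (Fin 2))} (hb : Bornology.IsBounded Λ) (u : (EuclideanSpace ℝ (Fin 2))) :
    Bornology.IsBounded ((· + u) ⁻¹' Λ) := by
  obtain ⟨R, hR⟩ := (Metric.isBounded_iff_subset_closedBall (0 : (EuclideanSpace ℝ (Fin 2)))).1 hb
  refine (Metric.isBounded_iff_subset_closedBall (-u)).2 ⟨R, fun x hx => ?_⟩
  have h := hR hx
  rw [Metric.mem_closedBall, dist_zero_right] at h
  rw [Metric.mem_closedBall, dist_eq_norm, sub_neg_eq_add]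
  exact h

/-- **Translations map Gibbs measures to Gibbs measures**: `μ ∘ g_u⁻¹ ∈ 𝒢_𝒳(U_hc, z)` for
`μ ∈ 𝒢_𝒳(U_hc, z)` (the DLR equation in `Λ` for `μ ∘ g_u⁻¹` is the DLR equation in `Λ - u` for
`μ`, by `gibbsKernel_translate`). [cite: Richthammer2007, §4.3 (p. 10)] -/
theorem IsGibbs.map_translate {z : ℝ} {μ : Measure (PointConfig (EuclideanSpace ℝ (Fin 2)))} (hμ : IsGibbs z μ) (u : (EuclideanSpace ℝ (Fin 2))) :
    IsGibbs z (μ.map (PointConfig.translate u)) := by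
  haveI := hμ.1
  refine ⟨Measure.isProbabilityMeasure_map (PointConfig.measurable_translate u).aemeasurable,
    fun Λ hΛ hb A hA => ?_⟩
  -- `g_u` as a measurable automorphism of `𝒳`, for the change of variables in `∫ ⋯ d(μ ∘ g_u⁻¹)`
  let e : PointConfig (EuclideanSpace ℝ (Fin 2)) ≃ᵐ PointConfig (EuclideanSpace ℝ (Fin 2)) :=
    { toFun := PointConfig.translate u
      invFun := PointConfig.translate (-u)
      left_inv := fun c => translate_translate_neg u c
      right_inv := fun c => translate_neg_translate u c
      measurable_toFun := PointConfig.measurable_translate u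
      measurable_invFun := PointConfig.measurable_translate (-u) }
  rw [Measure.map_apply (PointConfig.measurable_translate u) hA,
    hμ.2 _ ((measurable_add_const u) hΛ) (isBounded_preimage_add hb u) _
      (hA.preimage (PointConfig.measurable_translate u)),
    show (PointConfig.translate u : PointConfig (EuclideanSpace ℝ (Fin 2)) →
      PointConfig (EuclideanSpace ℝ (Fin 2))) = ⇑e from rfl,
    lintegral_map_equiv]
  refine lintegral_congr fun Y => ?_
  exact (gibbsKernel_translate z Λ Y A u).symm

/-! ### Tail events are stable under translations -/

/-- `g_u⁻¹ 𝓕_{𝒳,Λ_mᶜ} ⊆ 𝓕_{𝒳,Λ_kᶜ}` whenever `Λ_k + u ⊆ Λ_m`, here with the explicit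
`m = k + ⌈|u₁|⌉ + ⌈|u₂|⌉` (from `preimage_add_box_subset`). [cite: Richthammer2007, §3.2 (p. 6)] -/
theorem isCylinderEvent_compl_box_preimage_translate (k : ℕ) (u : EuclideanSpace ℝ (Fin 2))
    {T : Set (PointConfig (EuclideanSpace ℝ (Fin 2)))}
    (hT : IsCylinderEvent (box ((k + ⌈|(-u) 0|⌉₊ + ⌈|(-u) 1|⌉₊ : ℕ) : ℝ))ᶜ T) :
    IsCylinderEvent (box (k : ℝ))ᶜ (PointConfig.translate u ⁻¹' T) := by
  obtain ⟨C, hC, rfl⟩ := MeasurableSpace.measurableSet_comap.1 hT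
  have hPm : MeasurableSet ((· + u) ⁻¹' box ((k + ⌈|(-u) 0|⌉₊ + ⌈|(-u) 1|⌉₊ : ℕ) : ℝ)) :=
    (measurable_add_const u) (measurableSet_box _)
  have hkP : box (k : ℝ) ⊆ (· + u) ⁻¹' box ((k + ⌈|(-u) 0|⌉₊ + ⌈|(-u) 1|⌉₊ : ℕ) : ℝ) := by
    intro y hy
    have h1 : y + u ∈ (fun w => w + (-u)) ⁻¹' box (k : ℝ) := by simpa using hy
    exact preimage_add_box_subset k (-u) h1
  refine MeasurableSpace.measurableSet_comap.2
    ⟨(fun W => (W.restrict ((· + u) ⁻¹' box ((k + ⌈|(-u) 0|⌉₊ + ⌈|(-u) 1|⌉₊ : ℕ) : ℝ))ᶜ).translate u) ⁻¹' C,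
      ((PointConfig.measurable_translate u).comp (PointConfig.measurable_restrict hPm.compl)) hC, ?_⟩
  ext Y
  simp only [mem_preimage]
  rw [PointConfig.restrict_translate, Set.preimage_compl,
    PointConfig.restrict_restrict_of_subset (compl_subset_compl.2 hkP)]

/-- **Tail events are stable under translations**: `g_u⁻¹(T) ∈ 𝓕_{𝒳,∞}` for `T ∈ 𝓕_{𝒳,∞}`
(`= ⋂_m 𝓕_{𝒳,Λ_mᶜ}`). [cite: Richthammer2007, §3.2 (p. 6) and §4.3 (p. 10)] -/
theorem forall_isCylinderEvent_compl_box_preimage_translate (u : EuclideanSpace ℝ (Fin 2))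
    {T : Set (PointConfig (EuclideanSpace ℝ (Fin 2)))} (hT : ∀ m : ℕ, IsCylinderEvent (box (m : ℝ))ᶜ T)
    (k : ℕ) : IsCylinderEvent (box (k : ℝ))ᶜ (PointConfig.translate u ⁻¹' T) :=
  isCylinderEvent_compl_box_preimage_translate k u (hT _)

end Literature.Barriers.AtomisticToContinuum.HardDisk

end
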